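import Summits.Ventures.QEC.CircuitDistance.PortWindow
import Summits.Ventures.QEC.CircuitDistance.ClaimsQ4
import Summits.Ventures.QEC.CircuitDistance.SchedNormalise
import HarnessLib

/-!
# Q4 lane, ₛ-spine (6): the WINDOW LEMMA for any CNOT order — `HasAtₛ σ S Nc w → HasAtₛ σ S (min Nc w) w`
# (venture QEC, experiment cell CDX; drafted by qec-cdx-idea-2 g2, typed by qec-cdx-type-2, statement audit qec-cdx-crit-1, director-qec R158; the `PortWindow.lean` layer of record re-pointed to `allEventsₛ σ Nc`
# under `hσ : σ.CycleFacts S` only; nothing here asserts a value of `d_circ`)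

Proof as in `PortWindow.lean` (minimum-`faultCount` NORMAL witness; GAP `undetectable_splitₛ`; SHIFT `shift_normalₛ`; TRUNCATE
`transfer_normalₛ`); `Loc.cyc/retag`, `shiftBack`, `shiftBack_injOn`, `bsum_image_of_injOn`, `faultCount_union_of_cyc`,
`card_image_cyc_le` are the tree's (order-free).
* `detZₛ_shift` / `detXₛ_shift` / `dataXₛ_shift` / `dataZₛ_shift`, `shift_normalₛ`, `Gen.nonempty_of_logicalError`;
* **`hasAtₛ_window`**, `hasAtₛ_iff_min`, **`hasLogicalFaultₛ_iff_at`** (`HasLogicalFaultOfWeightAtMostₛ σ S w ↔ HasAtₛ σ S w w`: the single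
  circuit size `N₀ = w` decides the `∃ Nc` question), `not_hasAtₛ_of_not_hasAtₛ_self`;
* ORDER #345: `sched345_hasLogicalFaultₛ_iff_at`, **`CDX_Q4_345_iff_at : CDX_Q4_345 ↔ HasAtₛ sched345 bb144SM 10 10`** and
  `not_CDX_Q4_345_of_not_at` — the pre-registered `∃ Nc` question Q4 #345 is decided by the ten-cycle circuit of order #345 (this is
  the «mono/window» step of R156's propose order; the DEM bridge for `sched345` at `Nc = 10` is the next file).
Generic in `σ` and `S`.
-/

namespace Summit.Ventures.QEC.CircuitDistance

open Literature.InformationTheory.QuantumCodes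

variable {ℓ m : ℕ} [NeZero ℓ] [NeZero m]

/-! ## Shift in time -/

/-- Shifting a normal fault shifts its `Z`-column. -/
theorem detZₛ_shift {σ : SMSchedule} {S : SMCode ℓ m} (hσ : σ.CycleFacts S) (Nc d : ℕ) (f : Fault ℓ m) (hf : f.isInitZ = false) (h₁ : d + 1 ≤ f.cyc)
    (h₂ : f.cyc ≤ Nc) (t : ℕ) (j : BB.Mono ℓ m) :
    Gen.detZ S Nc (allEventsₛ σ Nc) {shiftBack d f} t j = Gen.detZ S Nc (allEventsₛ σ Nc) {f} (t + d) j := by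
  have hc' : (shiftBack d f).cyc = f.cyc - d := Fault.cyc_retag _ _
  have hI' : (shiftBack d f).isInitZ = false := by unfold shiftBack; rw [Fault.isInitZ_retag]; exact hf
  rw [detZₛ_singleton hσ Nc (shiftBack d f) (by rw [hc']; omega) (by rw [hc']; omega), detZₛ_singleton hσ Nc f (by omega) h₂,
    ancZxₛ_of_not_initZ σ S _ hI', ancZxₛ_of_not_initZ σ S f hf, hc']
  unfold shiftBack
  rw [shapeₛ_retag]
  dsimp only
  rw [if_pos rfl]
  simp only [Bool.and_false, Bool.xor_false]
  generalize (shapeₛ σ S f).mZ f.cyc j = μ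
  generalize synZ S (shapeₛ σ S f).frame.dataXb j = sy
  by_cases h0 : t + d = f.cyc
  · rw [decide_eq_true h0, decide_eq_true (show t = f.cyc - d by omega), decide_eq_false (show ¬ t + d = f.cyc + 1 by omega),
      decide_eq_false (show ¬ t = f.cyc - d + 1 by omega)]
  · rw [decide_eq_false h0, decide_eq_false (show ¬ t = f.cyc - d by omega)]
    by_cases h1 : t + d = f.cyc + 1
    · rw [decide_eq_true h1, decide_eq_true (show t = f.cyc - d + 1 by omega)]
    · rw [decide_eq_false h1, decide_eq_false (show ¬ t = f.cyc - d + 1 by omega)]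

/-- Shifting a normal fault shifts its `X`-column. -/
theorem detXₛ_shift {σ : SMSchedule} {S : SMCode ℓ m} (hσ : σ.CycleFacts S) (Nc d : ℕ) (f : Fault ℓ m) (h₁ : d + 1 ≤ f.cyc) (h₂ : f.cyc ≤ Nc) (t : ℕ)
    (i : BB.Mono ℓ m) : Gen.detX S Nc (allEventsₛ σ Nc) {shiftBack d f} t i = Gen.detX S Nc (allEventsₛ σ Nc) {f} (t + d) i := by
  have hc' : (shiftBack d f).cyc = f.cyc - d := Fault.cyc_retag _ _
  rw [detXₛ_singleton hσ Nc (shiftBack d f) (by rw [hc']; omega) (by rw [hc']; omega), detXₛ_singleton hσ Nc f (by omega) h₂, hc']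
  unfold shiftBack
  rw [shapeₛ_retag]
  dsimp only
  rw [if_pos rfl]
  generalize (shapeₛ σ S f).mX f.cyc i = μ
  generalize synX S (shapeₛ σ S f).frame.dataZb i = sy
  by_cases h0 : t + d = f.cyc
  · rw [decide_eq_true h0, decide_eq_true (show t = f.cyc - d by omega), decide_eq_false (show ¬ t + d = f.cyc + 1 by omega),
      decide_eq_false (show ¬ t = f.cyc - d + 1 by omega)]
  · rw [decide_eq_false h0, decide_eq_false (show ¬ t = f.cyc - d by omega)]
    by_cases h1 : t + d = f.cyc + 1
    · rw [decide_eq_true h1, decide_eq_true (show t = f.cyc - d + 1 by omega)]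
    · rw [decide_eq_false h1, decide_eq_false (show ¬ t = f.cyc - d + 1 by omega)]

/-- Shifting keeps the residual `X`-error. -/
theorem dataXₛ_shift {σ : SMSchedule} {S : SMCode ℓ m} (hσ : σ.CycleFacts S) (Nc d : ℕ) (f : Fault ℓ m) (h₁ : d + 1 ≤ f.cyc) (h₂ : f.cyc ≤ Nc) :
    Gen.dataX S (allEventsₛ σ Nc) {shiftBack d f} = Gen.dataX S (allEventsₛ σ Nc) {f} := by
  have hc' : (shiftBack d f).cyc = f.cyc - d := Fault.cyc_retag _ _
  rw [dataXₛ_singleton hσ Nc (shiftBack d f) (by rw [hc']; omega) (by rw [hc']; omega), dataXₛ_singleton hσ Nc f (by omega) h₂]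
  unfold shiftBack; rw [shapeₛ_retag]

/-- Shifting keeps the residual `Z`-error. -/
theorem dataZₛ_shift {σ : SMSchedule} {S : SMCode ℓ m} (hσ : σ.CycleFacts S) (Nc d : ℕ) (f : Fault ℓ m) (h₁ : d + 1 ≤ f.cyc) (h₂ : f.cyc ≤ Nc) :
    Gen.dataZ S (allEventsₛ σ Nc) {shiftBack d f} = Gen.dataZ S (allEventsₛ σ Nc) {f} := by
  have hc' : (shiftBack d f).cyc = f.cyc - d := Fault.cyc_retag _ _
  rw [dataZₛ_singleton hσ Nc (shiftBack d f) (by rw [hc']; omega) (by rw [hc']; omega), dataZₛ_singleton hσ Nc f (by omega) h₂]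
  unfold shiftBack; rw [shapeₛ_retag]


/-! ## The shift lemma -/

/-- **SHIFT LEMMA.** Translating a normal set back in time by `d` cycles (all cycles stay `≥ 1`) preserves normality,
undetectability, the residuals (hence the logical error) and does not increase the number of faulty operations; all cycles
drop by `d`. -/
theorem shift_normalₛ {σ : SMSchedule} {S : SMCode ℓ m} (hσ : σ.CycleFacts S) (Nc d : ℕ) (F : Finset (Fault ℓ m))
    (hN : Normal Nc F) (hd : ∀ f ∈ F, d + 1 ≤ f.cyc) (hU : Undetectableₛ σ S Nc F) (hL : LogicalErrorₛ σ S Nc F) :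
    Normal Nc (F.image (shiftBack d)) ∧ Undetectableₛ σ S Nc (F.image (shiftBack d)) ∧
      LogicalErrorₛ σ S Nc (F.image (shiftBack d)) ∧ faultCount (F.image (shiftBack d)) ≤ faultCount F ∧
      ∀ f' ∈ F.image (shiftBack d), f'.cyc + d ≤ Nc := by
  unfold Undetectableₛ at hU ⊢
  classical
  have hinj := shiftBack_injOn d F hd
  have hN' : Normal Nc (F.image (shiftBack d)) := by
    intro f' hf'
    obtain ⟨f, hf, rfl⟩ := Finset.mem_image.1 hf'
    refine ⟨?_, ?_, ?_⟩
    · show 1 ≤ (f.retag _).cyc; rw [Fault.cyc_retag]; have := hd f hf; omega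
    · show (f.retag _).cyc ≤ Nc; rw [Fault.cyc_retag]; have := (hN f hf).2.1; omega
    · show (f.retag _).isInitZ = false; rw [Fault.isInitZ_retag]; exact (hN f hf).2.2
  have hZ : ∀ t j, Gen.detZ S Nc (allEventsₛ σ Nc) (F.image (shiftBack d)) t j = Gen.detZ S Nc (allEventsₛ σ Nc) F (t + d) j := by
    intro t j
    rw [Gen.detZ_eq_bsum, bsum_image_of_injOn hinj, Gen.detZ_eq_bsum S Nc (allEventsₛ σ Nc) F]
    exact bsum_congr fun f hf => detZₛ_shift hσ Nc d f (hN f hf).2.2 (hd f hf) (hN f hf).2.1 t j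
  have hX : ∀ t i, Gen.detX S Nc (allEventsₛ σ Nc) (F.image (shiftBack d)) t i = Gen.detX S Nc (allEventsₛ σ Nc) F (t + d) i := by
    intro t i
    rw [Gen.detX_eq_bsum, bsum_image_of_injOn hinj, Gen.detX_eq_bsum S Nc (allEventsₛ σ Nc) F]
    exact bsum_congr fun f hf => detXₛ_shift hσ Nc d f (hd f hf) (hN f hf).2.1 t i
  have hdX : Gen.dataX S (allEventsₛ σ Nc) (F.image (shiftBack d)) = Gen.dataX S (allEventsₛ σ Nc) F := by
    rw [Gen.dataX_eq_sum, Finset.sum_image hinj, Gen.dataX_eq_sum S (allEventsₛ σ Nc) F]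
    exact Finset.sum_congr rfl fun f hf => dataXₛ_shift hσ Nc d f (hd f hf) (hN f hf).2.1
  have hdZ : Gen.dataZ S (allEventsₛ σ Nc) (F.image (shiftBack d)) = Gen.dataZ S (allEventsₛ σ Nc) F := by
    rw [Gen.dataZ_eq_sum, Finset.sum_image hinj, Gen.dataZ_eq_sum S (allEventsₛ σ Nc) F]
    exact Finset.sum_congr rfl fun f hf => dataZₛ_shift hσ Nc d f (hd f hf) (hN f hf).2.1
  refine ⟨hN', ⟨fun f' hf' => ?_, fun t i => ⟨?_, ?_⟩⟩, ?_, ?_, fun f' hf' => ?_⟩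
  · rw [hσ.mem_allEventsₛ_iff, Fault.ev_cyc]; exact ⟨(hN' f' hf').1, (hN' f' hf').2.1⟩
  · rw [hX]; exact (hU.2 _ i).1
  · rw [hZ]; exact (hU.2 _ i).2
  · unfold LogicalErrorₛ Gen.LogicalError at hL ⊢; rw [hdX, hdZ]; exact hL
  · -- faultCount: locations move along `Loc.retag`
    unfold faultCount
    have : (F.image (shiftBack d)).image Fault.loc = (F.image Fault.loc).image fun L => L.retag (L.cyc - d) := by
      rw [Finset.image_image, Finset.image_image]
      apply Finset.image_congr
      intro f _
      show (f.retag (f.cyc - d)).loc = f.loc.retag (f.loc.cyc - d)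
      rw [Fault.loc_retag, Fault.cyc_eq_loc_cyc]
    rw [this]; exact Finset.card_image_le
  · obtain ⟨f, hf, rfl⟩ := Finset.mem_image.1 hf'
    show (f.retag _).cyc + d ≤ Nc
    rw [Fault.cyc_retag]; have := (hN f hf).2.1; have := hd f hf; omega

/-! ## The window -/

/-- An undetectable LOGICAL fault set is non-empty. -/
theorem Gen.nonempty_of_logicalError (S : SMCode ℓ m) (es : List Ev) (F : Finset (Fault ℓ m))
    (hL : Gen.LogicalError S es F) : F.Nonempty := by
  rw [Finset.nonempty_iff_ne_empty]
  rintro rfl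
  apply hL
  have hX : Gen.dataX S es (∅ : Finset (Fault ℓ m)) = 0 := by rw [Gen.dataX_eq_sum, Finset.sum_empty]
  have hZ : Gen.dataZ S es (∅ : Finset (Fault ℓ m)) = 0 := by rw [Gen.dataZ_eq_sum, Finset.sum_empty]
  rw [hX, hZ]
  exact ⟨Submodule.zero_mem _, Submodule.zero_mem _⟩

/-- **WINDOW LEMMA (T3).** If some `Nc`-cycle circuit has an undetectable logical fault set of `≤ w` faulty operations, so
does the `min Nc w`-cycle circuit. -/
theorem hasAtₛ_window {σ : SMSchedule} {S : SMCode ℓ m} (hσ : σ.CycleFacts S) (Nc w : ℕ) :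
    HasLogicalFaultOfWeightAtMostAtₛ σ S Nc w → HasLogicalFaultOfWeightAtMostAtₛ σ S (min Nc w) w := by
  classical
  intro h
  rcases Nat.le_total Nc w with hle | hle
  · rw [min_eq_left hle]; exact h
  rw [min_eq_right hle]
  -- a minimal normal witness
  have hex : ∃ k, ∃ F : Finset (Fault ℓ m), Normal Nc F ∧ Undetectableₛ σ S Nc F ∧ LogicalErrorₛ σ S Nc F ∧ faultCount F = k ∧
      k ≤ w := by
    obtain ⟨F, hU, hL, hw⟩ := h
    obtain ⟨F', hN, hU', hL', hc⟩ := exists_normalₛ hσ Nc F hU hL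
    exact ⟨_, F', hN, hU', hL', rfl, hc.trans hw⟩
  obtain ⟨F, hN, hU, hL, hk, hkw⟩ := Nat.find_spec hex
  have hmin : ∀ k < Nat.find hex, ¬ ∃ F : Finset (Fault ℓ m), Normal Nc F ∧ Undetectableₛ σ S Nc F ∧ LogicalErrorₛ σ S Nc F ∧
      faultCount F = k ∧ k ≤ w := fun k hk => Nat.find_min hex hk
  set k₀ := Nat.find hex with hk₀
  have hne := Gen.nonempty_of_logicalError S (allEventsₛ σ Nc) F hL
  -- the cycles used
  set C := F.image Fault.cyc with hC
  have hCne : C.Nonempty := hne.image _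
  set a := C.min' hCne with ha
  set b := C.max' hCne with hb
  have haC : a ∈ C := Finset.min'_mem C hCne
  have hbC : b ∈ C := Finset.max'_mem C hCne
  have hge : ∀ f ∈ F, a ≤ f.cyc := fun f hf => Finset.min'_le C _ (Finset.mem_image_of_mem _ hf)
  have hle' : ∀ f ∈ F, f.cyc ≤ b := fun f hf => Finset.le_max' C _ (Finset.mem_image_of_mem _ hf)
  have ha1 : 1 ≤ a := by obtain ⟨f, hf, hfa⟩ := Finset.mem_image.1 haC; rw [← hfa]; exact (hN f hf).1
  -- GAP: the cycles form an interval of length ≤ k₀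
  have hspan : b + 1 ≤ a + k₀ := by
    by_contra hcon
    have hCcard : C.card ≤ k₀ := hk ▸ card_image_cyc_le F
    have hlt : C.card < (Finset.Icc a b).card := by rw [Nat.card_Icc]; omega
    obtain ⟨s, hsI, hsC⟩ := Finset.exists_mem_notMem_of_card_lt_card hlt
    rw [Finset.mem_Icc] at hsI
    have hsa : a < s := lt_of_le_of_ne hsI.1 (fun h => hsC (h ▸ haC))
    have hsb : s < b := lt_of_le_of_ne hsI.2 (fun h => hsC (h ▸ hbC))
    have hs : ∀ f ∈ F, f.cyc ≠ s := fun f hf hfs => hsC (hfs ▸ Finset.mem_image_of_mem _ hf)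
    obtain ⟨hUA, hUB⟩ := undetectable_splitₛ hσ Nc F hN hU s hs
    set A := F.filter fun f => f.cyc < s
    set B := F.filter fun f => s < f.cyc
    have hF : F = A ∪ B := by
      ext f; simp only [A, B, Finset.mem_union, Finset.mem_filter]
      constructor
      · intro hf; rcases Nat.lt_or_gt_of_ne (hs f hf) with h | h
        · exact Or.inl ⟨hf, h⟩
        · exact Or.inr ⟨hf, h⟩
      · rintro (⟨hf, -⟩ | ⟨hf, -⟩) <;> exact hf
    have hAB : Disjoint A B := by rw [Finset.disjoint_filter]; intro f _ h1 h2; omega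
    have hNA : Normal Nc A := fun f hf => hN f (Finset.mem_filter.1 hf).1
    have hNB : Normal Nc B := fun f hf => hN f (Finset.mem_filter.1 hf).1
    have hAne : A.Nonempty := by
      obtain ⟨f, hf, hfa⟩ := Finset.mem_image.1 haC
      exact ⟨f, Finset.mem_filter.2 ⟨hf, by omega⟩⟩
    have hBne : B.Nonempty := by
      obtain ⟨f, hf, hfb⟩ := Finset.mem_image.1 hbC
      exact ⟨f, Finset.mem_filter.2 ⟨hf, by omega⟩⟩
    have hcount : faultCount F = faultCount A + faultCount B := by
      rw [hF]; apply faultCount_union_of_cyc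
      intro x hx y hy; have := (Finset.mem_filter.1 hx).2; have := (Finset.mem_filter.1 hy).2; omega
    have hposA : 1 ≤ faultCount A := Finset.card_pos.2 (hAne.image _)
    have hposB : 1 ≤ faultCount B := Finset.card_pos.2 (hBne.image _)
    -- one of the halves is logical
    have hdX : Gen.dataX S (allEventsₛ σ Nc) F = Gen.dataX S (allEventsₛ σ Nc) A + Gen.dataX S (allEventsₛ σ Nc) B := by
      rw [Gen.dataX_eq_sum, Gen.dataX_eq_sum S (allEventsₛ σ Nc) A, Gen.dataX_eq_sum S (allEventsₛ σ Nc) B, hF,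
        Finset.sum_union hAB]
    have hdZ : Gen.dataZ S (allEventsₛ σ Nc) F = Gen.dataZ S (allEventsₛ σ Nc) A + Gen.dataZ S (allEventsₛ σ Nc) B := by
      rw [Gen.dataZ_eq_sum, Gen.dataZ_eq_sum S (allEventsₛ σ Nc) A, Gen.dataZ_eq_sum S (allEventsₛ σ Nc) B, hF,
        Finset.sum_union hAB]
    have hLAB : LogicalErrorₛ σ S Nc A ∨ LogicalErrorₛ σ S Nc B := by
      unfold LogicalErrorₛ
      rw [Gen.logicalError_iff, Gen.logicalError_iff]
      rcases (Gen.logicalError_iff S (allEventsₛ σ Nc) F).1 hL with hx | hz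
      · by_contra hcon; push Not at hcon
        apply hx; rw [hdX]
        exact Submodule.add_mem _ hcon.1.1 hcon.2.1
      · by_contra hcon; push Not at hcon
        apply hz; rw [hdZ]
        exact Submodule.add_mem _ hcon.1.2 hcon.2.2
    rcases hLAB with hLA | hLB
    · exact hmin (faultCount A) (by omega) ⟨A, hNA, hUA, hLA, rfl, by omega⟩
    · exact hmin (faultCount B) (by omega) ⟨B, hNB, hUB, hLB, rfl, by omega⟩
  -- SHIFT back by a - 1, then TRUNCATE to w cycles
  obtain ⟨hN', hU', hL', hc', hcyc'⟩ := shift_normalₛ hσ Nc (a - 1) F hN (fun f hf => by have := hge f hf; omega) hU hL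
  have hfit : ∀ f' ∈ F.image (shiftBack (a - 1)), f'.cyc ≤ w := by
    intro f' hf'
    obtain ⟨f, hf, rfl⟩ := Finset.mem_image.1 hf'
    show (f.retag _).cyc ≤ w
    rw [Fault.cyc_retag]; have := hle' f hf; omega
  obtain ⟨hU'', hL''⟩ := transfer_normalₛ hσ (F.image (shiftBack (a - 1))) hN' hfit hU' hL'
  exact ⟨_, hU'', hL'', hc'.trans (hk ▸ hkw)⟩

/-- crit-1's form of the window statement (`N₀ = w + 1` a fortiori). -/
theorem hasAtₛ_iff_min {σ : SMSchedule} {S : SMCode ℓ m} (hσ : σ.CycleFacts S) (Nc w : ℕ) :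
    HasLogicalFaultOfWeightAtMostAtₛ σ S Nc w ↔ HasLogicalFaultOfWeightAtMostAtₛ σ S (min Nc (w + 1)) w := by
  constructor
  · intro h
    rcases Nat.le_total Nc (w + 1) with hle | hle
    · rw [min_eq_left hle]; exact h
    · rw [min_eq_right hle]
      have h' := hasAtₛ_window hσ Nc w h
      rw [min_eq_right (by omega)] at h'
      exact hasAtₛ_mono_cycles hσ (Nat.le_succ w) w h'
  · intro h; exact hasAtₛ_mono_cycles hσ (Nat.min_le_left Nc (w + 1)) w h

/-- The `∃ Nc` predicate of the pre-registered questions is decided by the single circuit size `N₀ = w`. -/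
theorem hasLogicalFaultₛ_iff_at {σ : SMSchedule} {S : SMCode ℓ m} (hσ : σ.CycleFacts S) (w : ℕ) :
    HasLogicalFaultOfWeightAtMostₛ σ S w ↔ HasLogicalFaultOfWeightAtMostAtₛ σ S w w := by
  constructor
  · rintro ⟨Nc, h⟩
    have h' := hasAtₛ_window hσ Nc w h
    exact hasAtₛ_mono_cycles hσ (Nat.min_le_right Nc w) w h'
  · intro h; exact ⟨w, h⟩

/-- A refutation at `N₀ = w` refutes every circuit size. -/
theorem not_hasAtₛ_of_not_hasAtₛ_self {σ : SMSchedule} {S : SMCode ℓ m} (hσ : σ.CycleFacts S) (w : ℕ)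
    (h : ¬ HasLogicalFaultOfWeightAtMostAtₛ σ S w w) (Nc : ℕ) : ¬ HasLogicalFaultOfWeightAtMostAtₛ σ S Nc w :=
  fun h' => h ((hasLogicalFaultₛ_iff_at hσ w).1 ⟨Nc, h'⟩)


/-! ## Order #345: Q4 is decided at `N₀ = 10` -/

/-- For order #345 the `∃ Nc` predicate is decided by the single circuit size `N₀ = w` (any `S`). -/
theorem hasLogicalFaultₛ_iff_at_sched345 (S : SMCode ℓ m) (w : ℕ) :
    HasLogicalFaultOfWeightAtMostₛ sched345 S w ↔ HasLogicalFaultOfWeightAtMostAtₛ sched345 S w w :=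
  hasLogicalFaultₛ_iff_at (sched345_cycleFacts S) w

/-- The same for print's order, through the ₛ-spine (cross-check of `hasLogicalFault_iff_at`). -/
theorem hasLogicalFaultₛ_iff_at_sched204 (S : SMCode ℓ m) (w : ℕ) :
    HasLogicalFaultOfWeightAtMostₛ sched204 S w ↔ HasLogicalFaultOfWeightAtMostAtₛ sched204 S w w :=
  hasLogicalFaultₛ_iff_at (sched204_cycleFacts S) w

/-- `[[144,12,12]]`, order #345. -/
theorem sched345_hasLogicalFaultₛ_iff_at (w : ℕ) :
    HasLogicalFaultOfWeightAtMostₛ sched345 bb144SM w ↔ HasLogicalFaultOfWeightAtMostAtₛ sched345 bb144SM w w :=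
  hasLogicalFaultₛ_iff_at_sched345 bb144SM w

/-- **Q4 #345 is decided by the ten-cycle circuit of order #345** (pure consequence of the window lemma; no value asserted). -/
theorem CDX_Q4_345_iff_at : CDX_Q4_345 ↔ HasLogicalFaultOfWeightAtMostAtₛ sched345 bb144SM 10 10 :=
  sched345_hasLogicalFaultₛ_iff_at 10

/-- Hence a refutation at `Nc = 10` (e.g. a kernel-replayed complete DEM search of the ten-cycle circuit of order #345, the next files
of the lane) refutes `CDX_Q4_345`; with `WitnessesQ4`/`ClaimsQ4.CDX_Q4_345_neg_decided` that gives `circuitDistanceₛ sched345 bb144SM Nc = 11`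
for every `Nc ≥ 1`. -/
theorem not_CDX_Q4_345_of_not_at (h : ¬ HasLogicalFaultOfWeightAtMostAtₛ sched345 bb144SM 10 10) : ¬ CDX_Q4_345 :=
  fun hq => h (CDX_Q4_345_iff_at.1 hq)

/-- And a refutation at any SMALLER size already decides nothing less: monotonicity transports witnesses upward, so `¬ HasAtₛ … Nc 10` for
some `Nc ≥ 10` is equivalent to `¬ CDX_Q4_345`. -/
theorem not_CDX_Q4_345_iff_not_at (Nc : ℕ) (hNc : 10 ≤ Nc) : ¬ CDX_Q4_345 ↔ ¬ HasLogicalFaultOfWeightAtMostAtₛ sched345 bb144SM Nc 10 := by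
  refine not_congr ⟨fun hq => ?_, fun h => ⟨Nc, h⟩⟩
  exact hasAtₛ_mono_cycles (sched345_cycleFacts bb144SM) hNc 10 (CDX_Q4_345_iff_at.1 hq)

end Summit.Ventures.QEC.CircuitDistance
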